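import Literature.ModelTheory.ExponentialFields.SemialgebraicC1TriangulationGlue
import HarnessLib

/-!
# The panel beating theorem (Ohmoto–Shiota 2017, Thm. 3.1) as the residual content of
# `OhmotoShiota2017_c1Triangulation`

Topic `Literature/ModelTheory/ExponentialFields`. Fact decomposition (librarian, mode
`fact-decompose`, 2026-08-16) of the XL named fact
`Literature.ModelTheory.ExponentialFields.OhmotoShiota2017_c1Triangulation`
(`SemialgebraicC1Triangulation.lean`; T. Ohmoto, M. Shiota, J. Topology 10 (2017), Thm. 1.1 with
Thm. 2.2 and Thm. 3.1: compact semialgebraic sets admit finite semialgebraic triangulations with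
`C¹` realisation, compatible with finitely many semialgebraic subsets).

The printed proof of Thm. 1.1 (§3.2, first paragraph): triangulate semialgebraically (Thm. 2.2,
Łojasiewicz) and apply the **panel beating** Thm. 3.1 ("for any semialgebraic triangulation
`(K, f)` … there is a semialgebraic homeomorphism `χ` of `|K|` preserving every `σ ∈ K` such that
`f ∘ χ` is of class `C¹`"; "Theorem 1.1 is the case `X = Y` and `φ = id_X`"). Thm. 2.2 is PROVED in
the tree (`semialgebraic_triangulation`, `SemialgebraicTriangulationTheorem.lean`) and so is the
§3.2 reduction (`c1Triangulation_of_panelBeating`, `SemialgebraicC1TriangulationGlue.lean`), hence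
the split into the single consequence child

* `OhmotoShiota2017_panelBeating` (CHILD, named fact) — Thm. 3.1 for finite complexes `K ⊆ ℝⁿ` and
  continuous semialgebraic `φ : ℝⁿ → ℝᴹ`, in the printed ("Whitney") reading of "`φ ∘ χ` is of class
  `C¹` on `|K|`" (§1.1: a semialgebraic `C¹` map on a set is the restriction of a `C¹` map of a
  neighbourhood, "in fact, we can extend it to `ℝᵐ → ℝⁿ`"): `φ ∘ χ` agrees on `|K|` with a map
  `F` of class `C¹` on `ℝⁿ`. This is weaker than the hypothesis `hPB` of
  `c1Triangulation_of_panelBeating` (which asks `φ ∘ χ` itself to be `C¹` on all of `ℝⁿ`, more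
  than the source prints), so the assembly is re-proved here along the same lines;
* `OhmotoShiota2017_c1Triangulation_holds_of` (ASSEMBLY, proved).

The child does not restate the parent (it has a given triangulation as input and produces a
simplex-preserving re-parametrisation). Its printed proofs — Ohmoto–Shiota §3 (Lemmas 3.4–3.6) in
the corrected form of Czapla–Pawłucki (2018), §2, or Pawłucki (2024), §5 for `p = 1` — are the
object of the parent's seat (`SemialgebraicPanelBeating*.lean`, `SemialgebraicC1Cells.lean`,
`Semialgebraic{FlatReparam,Lenses,RichCuts,…,C1BoundaryExtension,AngleTower,Wing,…}.lean`,
2026-08-15/16).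

## References

* T. Ohmoto, M. Shiota, *`C¹`-triangulations of semialgebraic sets*, J. Topology 10 (2017)
  765–775 (arXiv:1505.03970), §1.1, Thm. 1.1, Thm. 2.2, Thm. 3.1, §3.2. [OhmotoShiota2017]
* M. Czapla, W. Pawłucki, *Strict `C¹`-triangulations in o-minimal structures*, Topol. Methods
  Nonlinear Anal. 52 (2018) 739–747, §2. [CzaplaPawlucki2018]
* W. Pawłucki, *Strict `C^p`-triangulations — a new approach to desingularization*, J. Eur. Math.
  Soc. 26 (2024), §5. [Pawlucki2024]
-/

noncomputable section

open Set Filter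
open _root_.Topology

namespace Literature.ModelTheory.ExponentialFields

section PanelBeating

open Literature.NumberTheory.Transcendental (IsSemialgebraicFunOn IsSemialgebraicMapOn
  isSemialgebraicMapOn_iff_forall_holds)

/-- NAMED FACT (split child of `OhmotoShiota2017_c1Triangulation`) — **panel beating**
(Ohmoto–Shiota 2017, Thm. 3.1; Czapla–Pawłucki 2018, §2): for every finite geometric simplicial
complex `K` in `ℝⁿ` and every continuous semialgebraic map `φ : ℝⁿ → ℝᴹ` there is a semialgebraic
homeomorphism `χ` of `ℝⁿ` (inverse `χ'`) preserving every open simplex of `K` such that `φ ∘ χ` is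
of class `C¹` on `|K|` in the sense of §1.1 of the source — it agrees on `K.space` with a map
`F : ℝⁿ → ℝᴹ` of class `C¹` (the printed `χ` is a homeomorphism of `|K|` preserving each `σ ∈ K`;
it extends to `ℝⁿ` by coning over a triangulation of a large simplex containing `K` as a
subcomplex, and the `C¹` realisation extends from a neighbourhood of the compact `|K|` to `ℝⁿ`).
[cite: OhmotoShiota2017, Thm. 3.1 and §1.1] [cite: CzaplaPawlucki2018, §2 (Thm. 1)] -/
def OhmotoShiota2017_panelBeating : Prop :=
  ∀ (n M : ℕ) (K : Geometry.SimplicialComplex ℝ (Fin n → ℝ)), K.faces.Finite →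
    ∀ φ : (Fin n → ℝ) → (Fin M → ℝ), Continuous φ → IsSemialgebraicMapOn ℝ univ φ →
      ∃ χ χ' : (Fin n → ℝ) → (Fin n → ℝ), IsSemialgHomeomorphOn ℝ univ univ χ χ' ∧
        (∀ σ ∈ K.faces, χ '' openSimplex ℝ σ = openSimplex ℝ σ) ∧
        ∃ F : (Fin n → ℝ) → (Fin M → ℝ), ContDiff ℝ 1 F ∧ EqOn F (φ ∘ χ) K.space

/-- Semialgebraicity of a map on a set only depends on its values there. [folklore] -/
theorem isSemialgebraicMapOn_congr {n m : ℕ} {s : Set (Fin n → ℝ)}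
    {f g : (Fin n → ℝ) → (Fin m → ℝ)} (hg : IsSemialgebraicMapOn ℝ s g) (h : EqOn f g s) :
    IsSemialgebraicMapOn ℝ s f := by
  have hset : {z : Fin (n + m) → ℝ | ∃ x ∈ s, z = Fin.append x (f x)} =
      {z : Fin (n + m) → ℝ | ∃ x ∈ s, z = Fin.append x (g x)} := by
    ext z
    constructor
    · rintro ⟨x, hx, rfl⟩
      exact ⟨x, hx, by rw [h hx]⟩
    · rintro ⟨x, hx, rfl⟩
      exact ⟨x, hx, by rw [h hx]⟩
  unfold IsSemialgebraicMapOn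
  rw [hset]
  exact hg

/-- ASSEMBLY of the split of `OhmotoShiota2017_c1Triangulation` (PROVED) — [OhmotoShiota2017,
§3.2]: triangulate `X` semialgebraically (`semialgebraic_triangulation`, Thm. 2.2, proved), extend the
triangulating homeomorphism `Ψ : |K| → X` to a continuous semialgebraic map `Ψ'` of the ambient space
(semialgebraic Tietze), beat (`OhmotoShiota2017_panelBeating`), and take as realisation the `C¹`
map `F` agreeing with `Ψ' ∘ χ` on `|K|`; compatibility is kept because `χ` preserves every open
simplex. (The proof of `c1Triangulation_of_panelBeating` with `Ψ' ∘ χ` replaced by `F`.)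
[cite: OhmotoShiota2017, Thm. 1.1, Thm. 2.2, Thm. 3.1] -/
theorem OhmotoShiota2017_c1Triangulation_holds_of (hPB : OhmotoShiota2017_panelBeating) :
    OhmotoShiota2017_c1Triangulation := by
  intro N X hX hXc 𝒜 h𝒜
  obtain ⟨K, Φ, Ψ, hK, hΦ, hcomp⟩ := semialgebraic_triangulation N X hX hXc 𝒜 h𝒜
  -- extend `Ψ` to the ambient space
  have hKc : IsCompact K.space := Literature.Analysis.Convexity.isCompact_space_of_finite hK
  have hKs : IsSemialgebraic ℝ K.space :=
    IsSemialgebraicMapOn.isSemialgebraic_holds hΦ.isSemialgebraicMapOn_symm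
  obtain ⟨Ψ', hΨ'c, hΨ's, hΨ'eq⟩ := exists_continuous_semialgebraic_extension_map hKc hKs
    hΦ.isSemialgebraicMapOn_symm hΦ.continuousOn_symm
  -- beat
  obtain ⟨χ, χ', hχ, hχσ, F, hF1, hFeq⟩ := hPB N N K hK Ψ' hΨ'c hΨ's
  have hχK : MapsTo χ K.space K.space := by
    intro p hp
    obtain ⟨σ, hσ, hpσ⟩ := exists_mem_openSimplex_of_mem_space hp
    have h : χ p ∈ openSimplex ℝ σ := by
      rw [← hχσ σ hσ]
      exact ⟨p, hpσ, rfl⟩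
    exact openSimplex_subset_space hσ h
  have hχ'K : MapsTo χ' K.space K.space := by
    intro p hp
    obtain ⟨σ, hσ, hpσ⟩ := exists_mem_openSimplex_of_mem_space hp
    have h : p ∈ χ '' openSimplex ℝ σ := by
      rw [hχσ σ hσ]
      exact hpσ
    obtain ⟨p', hp', rfl⟩ := h
    rw [hχ.left_inv (mem_univ _)]
    exact openSimplex_subset_space hσ hp'
  -- the realisation `F` agrees with `Ψ' ∘ χ`, hence with `Ψ ∘ χ`, on `|K|`
  have hFΨ : ∀ p ∈ K.space, F p = Ψ (χ p) := fun p hp => by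
    rw [hFeq hp, Function.comp_apply, hΨ'eq (hχK hp)]
  have hsa : IsSemialgebraicMapOn ℝ K.space (Ψ' ∘ χ) :=
    IsSemialgebraicMapOn.comp_holds hΨ's (hχ.isSemialgebraicMapOn.mono (subset_univ _) hKs)
      (mapsTo_univ _ _)
  refine ⟨N, K, F, χ' ∘ Φ, hK, ⟨?_, ?_, ?_, ?_, ?_, ?_, ?_⟩, hF1, ?_⟩
  · intro p hp
    rw [hFΨ p hp]
    exact hΦ.mapsTo_symm (hχK hp)
  · intro x hx
    exact hχ'K (hΦ.mapsTo hx)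
  · intro p hp
    show χ' (Φ (F p)) = p
    rw [hFΨ p hp, hΦ.right_inv (hχK hp), hχ.left_inv (mem_univ _)]
  · intro x hx
    have hm : χ' (Φ x) ∈ K.space := hχ'K (hΦ.mapsTo hx)
    show F (χ' (Φ x)) = x
    rw [hFΨ _ hm, hχ.right_inv (mem_univ _), hΦ.left_inv hx]
  · exact hF1.continuous.continuousOn
  · exact (hχ.continuousOn_symm.mono (subset_univ _)).comp hΦ.continuousOn
      (fun x _ => mem_univ _)
  · exact isSemialgebraicMapOn_congr hsa hFeq
  · intro A hA σ hσ hne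
    have himg : F '' openSimplex ℝ σ = Ψ '' openSimplex ℝ σ :=
      calc F '' openSimplex ℝ σ = (Ψ ∘ χ) '' openSimplex ℝ σ :=
            image_congr fun p hp => hFΨ p (openSimplex_subset_space hσ hp)
        _ = Ψ '' (χ '' openSimplex ℝ σ) := image_comp Ψ χ _
        _ = Ψ '' openSimplex ℝ σ := by rw [hχσ σ hσ]
    rw [himg] at hne ⊢
    exact hcomp A hA σ hσ hne

end PanelBeating

end Literature.ModelTheory.ExponentialFields

end
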